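import Literature.NumberTheory.EllipticCurves.Kato2004.ConditionVOfNotHasCMProofs
import Literature.NumberTheory.EllipticCurves.CMTorsionGaloisImageProofs
import Literature.NumberTheory.EllipticCurves.BSDSelmerCMPConverseKLevelProofs
import HarnessLib

/-!
# Kato 2004 (Astérisque 295), Thm. 13.4, hypothesis (v) for `T = T_pE` FAILS for every CM elliptic
# curve `E/ℚ` at every prime `p` — hence (v) holds for `T_pE` if and only if `E` has no CM
# (proofs file)

Topic `NumberTheory/EllipticCurves`, sub-directory `Kato2004`.  Theorems only (no definition, no
named fact, no `sorry`).  Cell `bsd-potss` (HOME `run/shared/lean/pub/bsd-potss/`), seat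
`bsd-potss-k8q-c2x` g6 (prover; lane B of the K8 Kato side, rung K8-Gss2 of `BirchSwinnertonDyer`,
route `QuadraticBranchSignedControl`, crux stmt-BirchSwinnertonDyer-20445
`PlusKatoDivisibilityBranchOnto`).  HONEST FRAMING: BSD is not proved by any of this; this file
decides an IMAGE HYPOTHESIS of a named Literature fact on the tree's objects (the fact itself,
Kato's Euler-system bound Thm. 13.4 = `Kato2004.thm13_4_lengthAt_fineSelmerDual_le_of_isEulerSystemClass`,
stays cite-level); nothing is booked.

Kato, Thm. 13.4 (p. 226), hypothesis (v): "There exists an element `σ` of `Gal(ℚ̄/ℚ(ζ_{p^∞}))` such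
that `dim_L(Coker(1 − σ ; T ⊗_{O_L} L → T ⊗_{O_L} L)) = 1`", and after the statement: "However if
`f` has CM, this theorem is not applied because the condition (v) is not satisfied in the CM case."
The sibling file `ConditionVOfNotHasCMProofs` (this seat, g5) PROVES (v) for `T_pE` for every
non-CM `E/ℚ` (Serre's open image).  THIS FILE proves Kato's remark — (v) FAILS for every CM `E/ℚ`,
at every prime `p`, on every Weierstrass model — and records the resulting DICHOTOMY
`(v) for T_pE ⟺ E has no complex multiplication`.

## The proof (Cartan normaliser, `p`-adically)

Let `E/ℚ` have CM.  The tree's form of Lang's Remark (*Elliptic Functions* Ch. 10 §4) /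
Silverman *AT* II.2.2(a), `WeierstrassCurve.exists_sq_eq_intCast_quadraticTwist_of_hasCM`, gives a
geometric endomorphism `ψ` with `ψ² = [D]`, `D < 0`, and a non-trivial quadratic character
`χ : Γ_ℚ → {±1}` with `ψ(σP) = χ(σ)·σψ(P)`.  On `T_pE` (functor `T_p`, `TateModule.map`) this reads
`Ψ² = D` and `Ψ ρ(σ) = χ(σ) ρ(σ) Ψ` (`tateModule_map_mul_galoisRepTate_of_twist`): the image of
`ρ_{E,p}` normalises the Cartan subgroup `ℚ_p[Ψ]ˣ ⊂ GL(V_pE)`, and `Ψ` is not a scalar (a scalar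
cannot anti-commute with the invertible `ρ(σ)`, `χ(σ) = −1`).  If `σ` fixes `μ_{p^∞}` then
`det ρ(σ) = χ_p(σ) = 1` (`det_galoisRepTate_eq_cyclotomicCharacter_holds`,
`cyclotomicCharacter_eq_one_of_forall_pow_eq_one`), and an element of determinant `1` of the
normaliser of a Cartan subgroup over a field of characteristic `≠ 2` is the identity or has no
eigenvalue `1` (`eq_one_or_det_sub_one_ne_zero_of_cartanNormalizer`, applied over `ℚ_p`): so
`ρ(σ) = 1` or `ρ(σ) − 1` is injective on `T_pE` (`det ≠ 0` over the domain `ℤ_p`), whence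
`rank_{ℤ_p} Coker(ρ(σ) − 1) ∈ {2, 0}`, never `1`.

* `Kato2004.galoisRepTate_eq_one_or_injective_sub_one_of_hasCM` — the dichotomy on `T_pE`;
* `Kato2004.finrank_coker_ne_one_of_hasCM`, `Kato2004.not_exists_finrank_coker_eq_one_of_hasCM` —
  **(v) fails for every CM `E/ℚ`, every model, every `p`** (Kato's remark, p. 226);
* `Kato2004.exists_finrank_coker_eq_one_iff_not_hasCM` — **(v) for `T_pE` ⟺ `E` non-CM** (with the
  sibling's `exists_finrank_coker_eq_one_of_not_hasCM_of_isElliptic`);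
* `Kato2004.not_exists_finrank_coker_eq_one_quadraticTwist_of_hasCM` — the same for every quadratic
  twist `E^{(d)}` (a twist of a CM curve is CM, `hasCM_quadraticTwist_of_hasCM`): the shape of the
  row binder `hv` of the K8 Kato-side road (`W = V ⊗ η = V^{(p*)}`), which is therefore
  unsatisfiable on the CM rows — the 13.4 road reaches EXACTLY the non-CM rows.

References: [Kato2004Asterisque] Thm. 13.4 (v) and the remark after it (p. 226); [Serre1972] §2.2
(normalisers of Cartan subgroups), §4.5 (CM image); [Lang1987] Ch. 10 §4, Remark;
[SerreAbelianLadic1968] Ch. IV §2.2.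
-/

noncomputable section

open scoped MatrixGroups Classical
open Field WeierstrassCurve Matrix
open Literature.NumberTheory.GaloisRepresentations Literature.NumberTheory.EllipticCurves

namespace Literature.NumberTheory.EllipticCurves.Kato2004

variable {p : ℕ} [Fact p.Prime]

/-! ## §1 `T_p` of a twisted-rational geometric endomorphism -/

/-- `T_p` of multiplication by an integer `D` on a discrete module is multiplication by `D`
(`T_ℓ` is an additive functor, Silverman, *AEC*, III.§7, proof of Thm. III.7.4).
[cite: SilvermanAEC2009, III.§7, Thm. III.7.4 (proof: T_ℓ is a ℤ_ℓ-linear functor)] -/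
theorem tateModule_map_intCast {A : Type*} [AddCommGroup A] (D : ℤ) :
    TateModule.map p (((D : AddMonoid.End A) : AddMonoid.End A) : A →+ A) =
      (D : ℤ_[p]) • (LinearMap.id : TateModule A p →ₗ[ℤ_[p]] TateModule A p) :=
  LinearMap.ext fun a ↦ TateModule.ext fun n ↦ by
    rw [TateModule.proj_map, LinearMap.smul_apply, LinearMap.id_apply, Int.cast_smul_eq_zsmul,
      map_zsmul]
    exact AddMonoid.End.intCast_apply D _

/-- **`T_p` of a geometric endomorphism `ψ` with `ψ(σP) = χ(σ)·σψ(P)` commutes with `ρ(σ)` up to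
the sign `χ(σ) = ±1`**: `T_p(ψ) ρ(σ) = ρ(σ) T_p(ψ)` if `χ(σ) = 1`, `T_p(ψ) ρ(σ) = −ρ(σ) T_p(ψ)` if
`χ(σ) = −1` (componentwise). For a CM curve over `ℚ` this is the statement that the image of
`ρ_{E,p}` normalises the Cartan subgroup `ℚ_p[T_p ψ]ˣ`. [cite: Serre1972, §4.5]
[cite: Lang1987, Ch. 10 §4, Remark] -/
theorem tateModule_map_mul_galoisRepTate_of_twist (W : WeierstrassCurve ℚ) [W.IsElliptic]
    {ψ : AddMonoid.End W.geomPoints} {χ : absoluteGaloisGroup ℚ →* ℤˣ}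
    (hrel : ∀ (σ : absoluteGaloisGroup ℚ) (P : W.geomPoints), ψ (σ • P) = ((χ σ : ℤˣ) : ℤ) • σ • ψ P)
    (σ : absoluteGaloisGroup ℚ) :
    (χ σ = 1 → TateModule.map p (ψ : W.geomPoints →+ W.geomPoints) * W.galoisRepTate p σ =
        W.galoisRepTate p σ * TateModule.map p (ψ : W.geomPoints →+ W.geomPoints)) ∧
      (χ σ = -1 → TateModule.map p (ψ : W.geomPoints →+ W.geomPoints) * W.galoisRepTate p σ =
        -(W.galoisRepTate p σ * TateModule.map p (ψ : W.geomPoints →+ W.geomPoints))) := by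
  refine ⟨fun h1 ↦ ?_, fun h1 ↦ ?_⟩
  · refine LinearMap.ext fun a ↦ TateModule.ext fun n ↦ ?_
    rw [Module.End.mul_apply, Module.End.mul_apply, TateModule.proj_map, galoisRepTate_apply_apply,
      galoisRepTate_apply_apply, TateModule.proj_smul_of_distribMulAction,
      TateModule.proj_smul_of_distribMulAction, TateModule.proj_map]
    have h := hrel σ (TateModule.proj p n a)
    rw [h1, Units.val_one, one_smul] at h
    exact h
  · refine LinearMap.ext fun a ↦ TateModule.ext fun n ↦ ?_
    rw [Module.End.mul_apply, LinearMap.neg_apply, Module.End.mul_apply, TateModule.proj_map,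
      galoisRepTate_apply_apply, galoisRepTate_apply_apply, map_neg,
      TateModule.proj_smul_of_distribMulAction, TateModule.proj_smul_of_distribMulAction,
      TateModule.proj_map]
    have h := hrel σ (TateModule.proj p n a)
    rw [h1, Units.val_neg, Units.val_one, neg_smul, one_smul] at h
    exact h

/-! ## §2 The Cartan-normaliser dichotomy on `T_pE` for a CM curve -/

/-- **On a CM curve `E/ℚ`, an element of `Γ_ℚ` of `p`-adic cyclotomic character `1` acts on `T_pE`
either trivially or without the eigenvalue `1`.** Let `E/ℚ` have (geometric) complex
multiplication, `p` any prime, and `σ ∈ Γ_ℚ` with `det ρ_{E,p}(σ) = 1`. Then `ρ_{E,p}(σ) = 1`, or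
`ρ_{E,p}(σ) − 1` is injective on `T_pE`. Proof: `Ψ = T_p(√D)` (`ψ² = [D]`, `D < 0`, twisted by the
CM character `χ`, `exists_sq_eq_intCast_quadraticTwist_of_hasCM`) is a non-scalar with `Ψ² = D`
normalised by `ρ(σ)` (`tateModule_map_mul_galoisRepTate_of_twist`); over `ℚ_p`,
`eq_one_or_det_sub_one_ne_zero_of_cartanNormalizer` gives `ρ(σ) = 1` or `det(ρ(σ) − 1) ≠ 0`, and a
`ℤ_p`-endomorphism of the free module `T_pE` with non-zero determinant is injective
(`Matrix.exists_mulVec_eq_zero_iff`). [cite: Serre1972, §2.2 and §4.5]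
[cite: Kato2004Asterisque, remark after Thm. 13.4 (p. 226)] -/
theorem galoisRepTate_eq_one_or_injective_sub_one_of_hasCM (W : WeierstrassCurve ℚ) [W.IsElliptic]
    (hCM : W.HasCM) (p : ℕ) [Fact p.Prime] (σ : absoluteGaloisGroup ℚ)
    (hdet : LinearMap.det (W.galoisRepTate p σ : W.tateModule p →ₗ[ℤ_[p]] W.tateModule p) = 1) :
    W.galoisRepTate p σ = 1 ∨
      Function.Injective (W.galoisRepTate p σ - 1 : W.tateModule p →ₗ[ℤ_[p]] W.tateModule p) := by
  classical
  have hp : p.Prime := Fact.out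
  have hp0 : (p : ℚ) ≠ 0 := Nat.cast_ne_zero.mpr hp.ne_zero
  haveI : Module.Free ℤ_[p] (W.tateModule p) := module_free_tateModule_holds W p
  haveI : Module.Finite ℤ_[p] (W.tateModule p) := module_finite_tateModule_holds W p
  let bT : Module.Basis (Fin 2) ℤ_[p] (W.tateModule p) :=
    Module.finBasisOfFinrankEq ℤ_[p] (W.tateModule p) (finrank_tateModule_eq_two_holds W p hp0)
  -- the CM endomorphism `ψ = √D` and its quadratic character `χ`
  obtain ⟨ψ, -, D, χ, hD, hψψ, ⟨τ, hτ⟩, hrel⟩ := W.exists_sq_eq_intCast_quadraticTwist_of_hasCM hCM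
  set Ψ : W.tateModule p →ₗ[ℤ_[p]] W.tateModule p :=
    TateModule.map p (ψ : W.geomPoints →+ W.geomPoints) with hΨdef
  have hΨΨ : Ψ * Ψ = (D : ℤ_[p]) • (1 : W.tateModule p →ₗ[ℤ_[p]] W.tateModule p) := by
    rw [hΨdef, Module.End.mul_eq_comp, ← TateModule.map_comp]
    have hcomp : (ψ : W.geomPoints →+ W.geomPoints).comp (ψ : W.geomPoints →+ W.geomPoints) =
        ((ψ * ψ : AddMonoid.End W.geomPoints) : W.geomPoints →+ W.geomPoints) := rfl
    rw [hcomp, hψψ]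
    exact tateModule_map_intCast D
  -- matrices over `ℤ_p`, then over `ℚ_p`
  set ι : ℤ_[p] →+* ℚ_[p] := algebraMap ℤ_[p] ℚ_[p] with hιdef
  have hι : Function.Injective ι := IsFractionRing.injective ℤ_[p] ℚ_[p]
  set Φ : Matrix (Fin 2) (Fin 2) ℤ_[p] := LinearMap.toMatrix bT bT Ψ with hΦdef
  set M : Matrix (Fin 2) (Fin 2) ℤ_[p] := LinearMap.toMatrix bT bT (W.galoisRepTate p σ) with hMdef
  have hΦΦ : Φ * Φ = (D : ℤ_[p]) • (1 : Matrix (Fin 2) (Fin 2) ℤ_[p]) := by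
    rw [hΦdef, ← LinearMap.toMatrix_mul, hΨΨ, LinearEquiv.map_smul, LinearMap.toMatrix_one]
  have hMdet : M.det = 1 := by rw [hMdef, LinearMap.det_toMatrix, hdet]
  -- matrix of `ρ(g)` for any `g`, and the normaliser relation for it
  have hnorm : ∀ g : absoluteGaloisGroup ℚ,
      Φ * LinearMap.toMatrix bT bT (W.galoisRepTate p g) =
          LinearMap.toMatrix bT bT (W.galoisRepTate p g) * Φ ∨
        Φ * LinearMap.toMatrix bT bT (W.galoisRepTate p g) =
          -(LinearMap.toMatrix bT bT (W.galoisRepTate p g) * Φ) := by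
    intro g
    obtain ⟨hc, ha⟩ := tateModule_map_mul_galoisRepTate_of_twist (p := p) W hrel g
    rcases Int.units_eq_one_or (χ g) with h | h
    · left
      rw [hΦdef, ← LinearMap.toMatrix_mul, hc h, LinearMap.toMatrix_mul]
    · right
      rw [hΦdef, ← LinearMap.toMatrix_mul, ha h, map_neg, LinearMap.toMatrix_mul]
  have hdetρ : ∀ g : absoluteGaloisGroup ℚ, (LinearMap.toMatrix bT bT (W.galoisRepTate p g)).det ≠ 0 := by
    intro g
    rw [LinearMap.det_toMatrix, det_galoisRepTate_eq_cyclotomicCharacter_holds W (ℓ := p) hp0 g]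
    exact Units.ne_zero _
  -- over `ℚ_p`
  set Φ' : Matrix (Fin 2) (Fin 2) ℚ_[p] := ι.mapMatrix Φ with hΦ'def
  set M' : Matrix (Fin 2) (Fin 2) ℚ_[p] := ι.mapMatrix M with hM'def
  have hsmul : ∀ (c : ℤ_[p]), ι.mapMatrix (c • (1 : Matrix (Fin 2) (Fin 2) ℤ_[p])) =
      (ι c) • (1 : Matrix (Fin 2) (Fin 2) ℚ_[p]) := by
    intro c
    ext i j
    simp [Matrix.one_apply, apply_ite ι]
  have hΦ'Φ' : Φ' * Φ' = ((D : ℤ_[p]) : ℚ_[p]) • (1 : Matrix (Fin 2) (Fin 2) ℚ_[p]) := by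
    rw [hΦ'def, ← map_mul, hΦΦ, hsmul]
    rfl
  have hD0 : ((D : ℤ_[p]) : ℚ_[p]) ≠ 0 := by
    rw [PadicInt.coe_intCast]
    exact_mod_cast hD.ne
  have h2 : (2 : ℚ_[p]) ≠ 0 := two_ne_zero
  -- `Φ'` is not a scalar: a scalar cannot anti-commute with the invertible `ρ(τ)`, `χ τ = -1`
  have hns : ∀ c : ℚ_[p], Φ' ≠ c • (1 : Matrix (Fin 2) (Fin 2) ℚ_[p]) := by
    intro c hc
    have hτ' : χ τ = -1 := (Int.units_eq_one_or (χ τ)).resolve_left hτ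
    set N : Matrix (Fin 2) (Fin 2) ℤ_[p] := LinearMap.toMatrix bT bT (W.galoisRepTate p τ) with hNdef
    have hanti : Φ * N = -(N * Φ) := by
      obtain ⟨-, ha⟩ := tateModule_map_mul_galoisRepTate_of_twist (p := p) W hrel τ
      rw [hΦdef, hNdef, ← LinearMap.toMatrix_mul, ha hτ', map_neg, LinearMap.toMatrix_mul]
    have hanti' : Φ' * ι.mapMatrix N = -(ι.mapMatrix N * Φ') := by
      rw [hΦ'def, ← map_mul, hanti, map_neg, map_mul]
    rw [hc, Matrix.smul_mul, Matrix.one_mul, Matrix.mul_smul, Matrix.mul_one] at hanti'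
    -- `c • N' = -(c • N')` forces `c • N' = 0`
    have hcN : c • ι.mapMatrix N = 0 := by
      have h3 : (2 : ℚ_[p]) • (c • ι.mapMatrix N) = 0 := by
        rw [two_smul]
        nth_rewrite 1 [hanti']
        exact neg_add_cancel _
      exact (smul_eq_zero.mp h3).resolve_left h2
    rcases smul_eq_zero.mp hcN with hc0 | hN0
    · -- `c = 0`: then `Φ' = 0`, contradicting `Φ'² = D ≠ 0`
      rw [hc0, zero_smul] at hc
      have h00 := congrArg (fun A : Matrix (Fin 2) (Fin 2) ℚ_[p] ↦ A 0 0) hΦ'Φ'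
      simp only [hc, Matrix.zero_mul, Matrix.zero_apply, Matrix.smul_apply, Matrix.one_apply_eq,
        smul_eq_mul, mul_one] at h00
      exact hD0 h00.symm
    · -- `N' = 0`: contradicts `det ρ(τ) ≠ 0`
      have hdN : (ι.mapMatrix N).det = 0 := by
        rw [hN0]
        exact Matrix.det_zero
      rw [← RingHom.map_det] at hdN
      exact hdetρ τ ((injective_iff_map_eq_zero ι).mp hι _ hdN)
  have hdich' : Φ' * M' = M' * Φ' ∨ Φ' * M' = -(M' * Φ') := by
    rcases hnorm σ with h | h <;> rw [← hMdef] at h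
    · left
      rw [hΦ'def, hM'def, ← map_mul, h, map_mul]
    · right
      rw [hΦ'def, hM'def, ← map_mul, h, map_neg, map_mul]
  have hM'det : M'.det = 1 := by
    rw [hM'def, ← RingHom.map_det, hMdet, map_one]
  rcases eq_one_or_det_sub_one_ne_zero_of_cartanNormalizer h2 hΦ'Φ' hD0 hns hdich' hM'det with
    hM1 | hMd
  · -- `ρ(σ) = 1`
    left
    have hM : M = 1 := by
      have h1 : ι.mapMatrix M = ι.mapMatrix 1 := by rw [← hM'def, hM1, map_one]
      exact Matrix.map_injective hι h1
    have h := (LinearMap.toMatrix bT bT).injective (hM.trans (LinearMap.toMatrix_one bT).symm)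
    exact h
  · -- `det (ρ(σ) - 1) ≠ 0`, hence `ρ(σ) - 1` is injective over the domain `ℤ_p`
    right
    have hdet1 : (M - 1).det ≠ 0 := by
      intro h0
      apply hMd
      rw [hM'def, ← map_one ι.mapMatrix, ← map_sub, ← RingHom.map_det, h0, map_zero]
    have hMsub : LinearMap.toMatrix bT bT (W.galoisRepTate p σ - 1) = M - 1 := by
      rw [map_sub, LinearMap.toMatrix_one]
    intro x y hxy
    rw [← sub_eq_zero] at hxy ⊢
    rw [← map_sub] at hxy
    set v := x - y with hvdef
    have hrepr : (M - 1) *ᵥ (bT.repr v) = 0 := by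
      rw [← hMsub, LinearMap.toMatrix_mulVec_repr, hxy, map_zero]
      rfl
    by_contra hv
    have hv' : (bT.repr v : Fin 2 → ℤ_[p]) ≠ 0 := by
      intro h0
      apply hv
      have : bT.repr v = 0 := Finsupp.ext fun i ↦ congrFun h0 i
      exact bT.repr.injective (by rw [this, map_zero])
    exact hdet1 ((Matrix.exists_mulVec_eq_zero_iff).mp ⟨_, hv', hrepr⟩)

/-- **Kato's hypothesis (v) fails on `T_pE` for every CM elliptic curve `E/ℚ`** (any Weierstrass
model, any prime `p`): if `σ ∈ Γ_ℚ` fixes every `p`-power root of unity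
(`σ ∈ Gal(ℚ̄/ℚ(ζ_{p^∞}))`), then `rank_{ℤ_p} Coker(ρ_{E,p}(σ) − 1 : T_pE → T_pE) ≠ 1` — it is `2`
(`ρ(σ) = 1`) or `0` (`ρ(σ) − 1` injective), by `galoisRepTate_eq_one_or_injective_sub_one_of_hasCM`
(`det ρ(σ) = χ_p(σ) = 1`: `det_galoisRepTate_eq_cyclotomicCharacter_holds`,
`cyclotomicCharacter_eq_one_of_forall_pow_eq_one`) and rank–nullity over the domain `ℤ_p`. Kato,
p. 226: "the condition (v) is not satisfied in the CM case".
[cite: Kato2004Asterisque, Thm. 13.4 (v) and the remark after it (p. 226)] [cite: Serre1972, §4.5] -/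
theorem finrank_coker_ne_one_of_hasCM (W : WeierstrassCurve ℚ) [W.IsElliptic] (hCM : W.HasCM)
    (p : ℕ) [Fact p.Prime] (σ : absoluteGaloisGroup ℚ)
    (hσ : ∀ (n : ℕ) (t : AlgebraicClosure ℚ), t ^ p ^ n = 1 → σ • t = t) :
    Module.finrank ℤ_[p] ((W.tateModule p) ⧸ LinearMap.range (W.galoisRepTate p σ - 1)) ≠ 1 := by
  classical
  have hp : p.Prime := Fact.out
  have hp0 : (p : ℚ) ≠ 0 := Nat.cast_ne_zero.mpr hp.ne_zero
  haveI : Module.Free ℤ_[p] (W.tateModule p) := module_free_tateModule_holds W p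
  haveI : Module.Finite ℤ_[p] (W.tateModule p) := module_finite_tateModule_holds W p
  have hT : Module.finrank ℤ_[p] (W.tateModule p) = 2 := finrank_tateModule_eq_two_holds W p hp0
  -- `det ρ(σ) = χ_p(σ) = 1`
  have hχ : GaloisRep.cyclotomicCharacter ℚ p σ = 1 := by
    rw [GaloisRep.cyclotomicCharacter_apply]
    exact cyclotomicCharacter_eq_one_of_forall_pow_eq_one p _ fun n t ht ↦ hσ n t ht
  have hdet : LinearMap.det (W.galoisRepTate p σ : W.tateModule p →ₗ[ℤ_[p]] W.tateModule p) = 1 := by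
    rw [det_galoisRepTate_eq_cyclotomicCharacter_holds W (ℓ := p) hp0 σ, hχ, Units.val_one]
  have hrn := Submodule.finrank_quotient_add_finrank (LinearMap.range (W.galoisRepTate p σ - 1))
  rcases galoisRepTate_eq_one_or_injective_sub_one_of_hasCM W hCM p σ hdet with h1 | hinj
  · -- `ρ(σ) = 1`: the cokernel is all of `T_pE`, of rank `2`
    have hbot : LinearMap.range (W.galoisRepTate p σ - 1) = ⊥ := by
      rw [LinearMap.range_eq_bot, h1, sub_self]
    rw [hbot, finrank_bot, hT] at hrn
    rw [hbot]
    omega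
  · -- `ρ(σ) − 1` injective: the image has rank `2`, the cokernel rank `0`
    rw [LinearMap.finrank_range_of_inj hinj, hT] at hrn
    omega

/-- **(v) fails for CM, in the shape of the binder of
`Kato2004.thm13_4_lengthAt_fineSelmerDual_le_of_isEulerSystemClass`**: for a CM elliptic curve
`E/ℚ` (any model) and any prime `p` there is NO `σ ∈ Gal(ℚ̄/ℚ(ζ_{p^∞}))` with
`rank_{ℤ_p} Coker(ρ_{E,p}(σ) − 1) = 1`. [cite: Kato2004Asterisque, Thm. 13.4 (v) and the remark after it (p. 226)] -/
theorem not_exists_finrank_coker_eq_one_of_hasCM (W : WeierstrassCurve ℚ) [W.IsElliptic]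
    (hCM : W.HasCM) (p : ℕ) [Fact p.Prime] :
    ¬ ∃ σ : absoluteGaloisGroup ℚ,
      (∀ (n : ℕ) (t : AlgebraicClosure ℚ), t ^ p ^ n = 1 → σ • t = t) ∧
        Module.finrank ℤ_[p]
          ((W.tateModule p) ⧸ LinearMap.range (W.galoisRepTate p σ - 1)) = 1 := by
  rintro ⟨σ, hσ, h1⟩
  exact finrank_coker_ne_one_of_hasCM W hCM p σ hσ h1

/-- **Dichotomy: Kato's Thm. 13.4 hypothesis (v) holds for `T = T_pE` if and only if `E` has no
complex multiplication** — for every elliptic curve `E/ℚ` (any Weierstrass model) and every prime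
`p`. `⟸`: Serre's open image (sibling `exists_finrank_coker_eq_one_of_not_hasCM_of_isElliptic`);
`⟹`: the Cartan-normaliser dichotomy (`not_exists_finrank_coker_eq_one_of_hasCM`). So the
reduction-free Euler-system bound Thm. 13.4 (2)(3) is available BY NAME on exactly the non-CM
curves; for CM curves Kato's bound is Thm. 12.5 via §15 (elliptic units), not 13.4.
[cite: Kato2004Asterisque, Thm. 13.4 (v) and the remark after it (p. 226); §15]
[cite: SerreAbelianLadic1968, Ch. IV §2.2 Théorème (IV-11)] [cite: Serre1972, §4.5] -/
theorem exists_finrank_coker_eq_one_iff_not_hasCM (W : WeierstrassCurve ℚ) [W.IsElliptic]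
    (p : ℕ) [Fact p.Prime] :
    (∃ σ : absoluteGaloisGroup ℚ,
      (∀ (n : ℕ) (t : AlgebraicClosure ℚ), t ^ p ^ n = 1 → σ • t = t) ∧
        Module.finrank ℤ_[p]
          ((W.tateModule p) ⧸ LinearMap.range (W.galoisRepTate p σ - 1)) = 1) ↔ ¬ W.HasCM :=
  ⟨fun h hCM ↦ not_exists_finrank_coker_eq_one_of_hasCM W hCM p h,
    fun h ↦ exists_finrank_coker_eq_one_of_not_hasCM_of_isElliptic W h p⟩

/-- **(v) fails on every quadratic twist of a CM curve** (a quadratic twist of a CM curve over `ℚ`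
has CM — same `j`-invariant, `hasCM_quadraticTwist_of_hasCM`): for CM `V/ℚ`, `d ≠ 0` and any prime
`p`, no `σ ∈ Gal(ℚ̄/ℚ(ζ_{p^∞}))` has `rank_{ℤ_p} Coker(ρ_{V^{(d)},p}(σ) − 1) = 1`. With
`d = p* = (−1)^{⌊p/2⌋} p` this is the NEGATION of the row binder `hv` of the K8 Kato-side road
(`W = V ⊗ η`, rung K8 of `BirchSwinnertonDyer`): the Thm. 13.4 road is void on the CM rows.
[cite: Kato2004Asterisque, Thm. 13.4 (v) and the remark after it (p. 226)]
[cite: SilvermanAEC2009, App. C §11 (C.11.3.1) with X.5.4] -/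
theorem not_exists_finrank_coker_eq_one_quadraticTwist_of_hasCM (V : WeierstrassCurve ℚ)
    [V.IsElliptic] (hCM : V.HasCM) {d : ℚ} (hd : d ≠ 0) (p : ℕ) [Fact p.Prime]
    [(V.quadraticTwist d).IsElliptic] :
    ¬ ∃ σ : absoluteGaloisGroup ℚ,
      (∀ (n : ℕ) (t : AlgebraicClosure ℚ), t ^ p ^ n = 1 → σ • t = t) ∧
        Module.finrank ℤ_[p]
          (((V.quadraticTwist d).tateModule p) ⧸
            LinearMap.range ((V.quadraticTwist d).galoisRepTate p σ - 1)) = 1 :=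
  not_exists_finrank_coker_eq_one_of_hasCM (V.quadraticTwist d)
    (hasCM_quadraticTwist_of_hasCM V hCM hd) p

end Literature.NumberTheory.EllipticCurves.Kato2004

end
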